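import Literature.Computability.QuantumComplexity.ForrelationComplete
import Literature.Computability.QuantumComplexity.ForrelationMemValue
import Literature.Computability.QuantumComplexity.Lemma24SignHard
import Literature.Computability.QuantumComplexity.QSimSignLift
import HarnessLib

/-!
# Discharge of `aaronson_ambainis_kForrelation_complete`: explicit poly-fold Forrelation is `PromiseBQP`-complete

Topic `Literature/Computability/QuantumComplexity`. This file only composes discharges that are
already in the tree (no new definitions, no new named facts). The named fact
`aaronson_ambainis_kForrelation_complete` of `ForrelationComplete.lean` — explicit `k`-fold
FORRELATION (`kForrelationProblem`, `k` part of the instance) is in `PromiseBQP` and every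
`PromiseBQP` problem Karp-reduces to it (S. Aaronson, A. Ambainis, *Forrelation*, SIAM J. Comput.
47 (2018) = arXiv:1411.5729, §1.1.3 Thm. 5; §6, p. 26 with §3.2 Prop. 6, Lemma 24, Thm. 25) — is
proved along the printed proof of §6, whose three steps were discharged in sibling files:

* membership (§6 p. 26 via Prop. 6): `AaronsonAmbainis2018_kForrelation_mem_holds`
  (`ForrelationMemValue.lean`, the uniform Clifford+`T` family running the `k`-query circuit of
  Fig. 2 with white-box phase queries);
* Lemma 24, hardness half, over the sign basis `{H, Z, CZ, CCZ}`:
  `AaronsonAmbainis2018_lemma24_sign_hard_holds` (`Lemma24SignHard.lean`, files I–XIII of the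
  `Lemma24*` series);
* Theorem 25 over the sign basis (the Karp reduction QSIM `≤ₚ` FORRELATION, Hadamard gadget
  `(H^{⊗2}·CSIGN)³ = SWAP` of p. 27 with the parity repair): `AaronsonAmbainis2018_thm25_sign_holds`
  (`ForrelationThm25EncodeFP.lean`), already folded into
  `aaronson_ambainis_kForrelation_complete_of_hard` (`ForrelationMemValue.lean`) together with
  membership and transitivity of Karp reductions (`PromiseProblem.PolyTimeReducible.trans_holds`).

Kept in a separate file because `ForrelationComplete.lean` (the statement) is imported by every
file of the proof (`ForrelationCompleteProofs.lean` onwards). As a by-product the literal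
`{H, CCSIGN}` form of Lemma 24 (`AaronsonAmbainis2018_lemma24_hard`, `ForrelationCompleteProofs.lean`)
is discharged too, through the exact lift `AaronsonAmbainis2018_lemma24_hard_of_sign_hard`
(`QSimSignLift.lean`).

## References

* S. Aaronson, A. Ambainis, *Forrelation: a problem that optimally separates quantum from
  classical computing*, SIAM J. Comput. 47 (2018) 982–1038; arXiv:1411.5729: §1.1.3 Thm. 5 (p. 5),
  §1.2, §3.2 Prop. 6 (p. 11), §6 Lemma 24 (p. 26) and Thm. 25 (p. 27).
* Y. Shi, *Both Toffoli and controlled-NOT need little help to do universal quantum computing*,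
  Quantum Inf. Comput. 3 (2003) 84–92.
* O. Goldreich, *On promise problems: a survey*, 2006, Def. 1.4 (Karp reductions of promise problems).
-/

noncomputable section

open Literature.Computability.Complexity Literature.Computability.Cryptography

namespace Literature.Computability.QuantumComplexity

/-- **DISCHARGE of `aaronson_ambainis_kForrelation_complete` (Aaronson–Ambainis 2018, Thm. 5 /
§6): explicit `k`-fold FORRELATION is `PromiseBQP`-complete** — in `PromiseBQP`
(`AaronsonAmbainis2018_kForrelation_mem_holds`) and `PromiseBQP`-hard under polynomial-time Karp
reductions of promise problems (Lemma 24 over the sign basis,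
`AaronsonAmbainis2018_lemma24_sign_hard_holds`, composed with Theorem 25,
`AaronsonAmbainis2018_thm25_sign_holds`, by `aaronson_ambainis_kForrelation_complete_of_hard`).
[cite: AaronsonAmbainis2018, §1.1.3 Thm. 5; §6 (p. 26 with §3.2 Prop. 6, Lemma 24, Thm. 25)] -/
theorem aaronson_ambainis_kForrelation_complete_holds : aaronson_ambainis_kForrelation_complete :=
  aaronson_ambainis_kForrelation_complete_of_hard AaronsonAmbainis2018_lemma24_sign_hard_holds

/-- **DISCHARGE of `AaronsonAmbainis2018_lemma24_hard` (AA Lemma 24, hardness half, over the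
literal basis `{H, CCSIGN}`)**: every `PromiseBQP` problem Karp-reduces in polynomial time to QSIM
over `{H, CCSIGN}` — the sign-basis hardness `AaronsonAmbainis2018_lemma24_sign_hard_holds` composed
with the exact lift `qSimSign_polyTimeReducible_qSim` (`AaronsonAmbainis2018_lemma24_hard_of_sign_hard`).
[cite: AaronsonAmbainis2018, §6 Lemma 24 (p. 26)] -/
theorem AaronsonAmbainis2018_lemma24_hard_holds : AaronsonAmbainis2018_lemma24_hard :=
  AaronsonAmbainis2018_lemma24_hard_of_sign_hard AaronsonAmbainis2018_lemma24_sign_hard_holds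

/-! ### Unconditional forms of the API of `ForrelationComplete.lean` -/

/-- Explicit `k`-fold FORRELATION is in `PromiseBQP` (unconditional form of
`kForrelationProblem_mem_PromiseBQP`). [cite: AaronsonAmbainis2018, §6 (p. 26) with §3.2 Prop. 6] -/
theorem kForrelationProblem_mem_PromiseBQP' : kForrelationProblem ∈ PromiseBQP :=
  kForrelationProblem_mem_PromiseBQP aaronson_ambainis_kForrelation_complete_holds

/-- Every `PromiseBQP` problem Karp-reduces in polynomial time to explicit `k`-fold FORRELATION
(unconditional form of `polyTimeReducible_kForrelationProblem`, the shape consumed by the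
PromiseLift route). [cite: AaronsonAmbainis2018, §6 (Lemma 24, Thm. 25)] -/
theorem polyTimeReducible_kForrelationProblem' {Q : PromiseProblem} (hQ : Q ∈ PromiseBQP) :
    PromiseProblem.PolyTimeReducible Q kForrelationProblem :=
  polyTimeReducible_kForrelationProblem aaronson_ambainis_kForrelation_complete_holds hQ

end Literature.Computability.QuantumComplexity

end
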